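import Mathlib
import HarnessLib
import Summits.CriticalPhenomena.PercolationContinuityZ3.Theorems.PercNearOneGluingNoHeavyLowerTailTwoCopyLadderCubic
import Summits.CriticalPhenomena.PercolationContinuityZ3.Theorems.PercNearOneGluingNoHeavyLowerTailTwoCopyLadderCubicGood

/-!
# Spokes and rails of ALL ladders at ALL grades: the two-copy core is coefficientwise nonnegative in `q`

Helper file for crux `stmt-CriticalPhenomena-4575` (new-inequality factory `prim-ineq-gen-1`, gen 19); memo
`run/shared/lean/prim/prim-ineq-gen-1/FINDING-26-all-grades-spokes-rails.md`.  Sequel to `…TwoCopyLadderCubic` (gen 18), whose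
`SVec`, `rungStep`, `base`, `sigma`, `Bspoke`, `pendW`, `Brail` are reused.

SETTING.  For a graph `G` with a 2-separation `G ∖ {e,f} = G₁ ∪_{u,w} G₂` and `e = av` across it, the two-copy core
`P_{e,f}(q;y) = A·B_U − A_U·B` of the programme (FINDING-24; `(1−q)·P = q·Δ_G{e,f}`, `Δ` the Rayleigh difference of the
random-cluster model, and `y_f·P = H_{G∖e}([e], J_f)`, the two-copy Harris form of CONJECTURE L) is a universal form in the
q-WEIGHTED 3-terminal type sums `L_q[π] = Σ_{A₁ : partition π} q^{#floating components} y^{A₁}` of the two sides (five per side: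
`c=[xuw], p=[xu|w], m=[xw|u], d=[x|uw], s=[x|u|w]`; memo §1, validated against brute force for every spoke, rail and rung of
`L_r + av`, `r ≤ 3`, as exact polynomial identities in `q` and all weights).  Adding vertices/edges to a side acts LINEARLY on the
type vector by q-dependent maps: `rungStep` (edge between the terminals, q-free), `qpendU`/`qpendW` (pendant edge at a terminal:
`m ↦ ρm + qm + c`, `s ↦ ρs + qs + d + p` — the old terminal's component may now float, weight `q`), `mergeUW`.

THIS FILE proves, over an arbitrary commutative ring `R` with a "positive cone" `P` (a predicate closed under `+`, `*` containing
`0, 1` — `IsPosCone`), for `q ∈ P` and all weights in `P`: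
* the side forms `Aq = p(c+p+m+d) + q·ps + (1−q)(md − cs)` (the q-deformation of `σ` of gen 18) and `Dl = cs − md` stay in `P`
  along the orbit `Orb` of the one-vertex side under the four moves (exact identities `Aq_rungStep` … `Dl_qpendW`, by `ring`);
* the all-grade SPOKE form `Qspoke q y₂ K = y₂²·Aq K + y₂·Bq K + C0q K` (`= P_{av,au₁}/q³`; `Bq`, `C0q` have nonnegative
  coefficients) is in `P` (`Qspoke_pos`), and `Qspoke 0 = Bspoke` of gen 18 (`Qspoke_zero`);
* the all-grade RAIL form `Frail q X Y` (`= P_{av,u_ju_{j+1}}/q³`, 94 monomials, symmetric in `X ↔ Y`, `Frail 0 = Brail`) satisfies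
  `Frail (rungStep t X) Y = Frail X Y + t(C+qM)(C+qD)·Aq X + m₁·Aq Y + m₂·Dl Y + N`, `Frail (qpendU ρ X) Y = ρ(ρ+q)·Frail X Y`,
  `Frail (qpendW ρ X) Y = ρ²·Frail X Y + N'`, `Frail (mergeUW X) Y = m₃·Aq Y`, `Frail triv Y = Aq Y` with `m₁, m₂, m₃, N, N'`
  polynomials with nonnegative integer coefficients (found by exact linear programming, checked here by `ring`) — hence
  `Frail q X Y ∈ P` for all `X, Y ∈ Orb` (`Frail_pos`).
Two instances of `P`: `0 ≤ ·` in an ordered ring (`isPosCone_nonneg`) — the two-copy core of every spoke and rail of every ladder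
is `≥ 0` for every real `q ≥ 0`, i.e. RAYLEIGH NEGATIVE CORRELATION `RC_q[av ∈ ω, f ∈ ω] ≤ RC_q[av]·RC_q[f]` of the apex edge with
every spoke and rail of every ladder at every `0 < q < 1` and all positive weights (`spoke_allq_nonneg`, `rail_allq_nonneg`); and
"all coefficients nonnegative" in a polynomial ring (`isPosCone_coeff`) — the GRADED statement: every q-coefficient of
`P_{L_r+av; av, f}` is `≥ 0`, i.e. the CONJ-L edge shadow `H_{L_r}([a~v], J_f) ⪰ 0` at ALL grades for spokes and rails
(`spoke_coeff_nonneg`, `rail_coeff_nonneg`).  The rungs (`Bform` of gen 18 and its q-deformation) are NOT covered: they have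
negative coefficients in the weights and need sums of squares.
NOT formalised: the identification of `Qspoke`/`Frail`/`Orb` with the graph polynomials (finite type bookkeeping, memo §1;
scripts `lab/qt.py`, `lab/v1_validate.py` of the gen-19 seat).  (This work, 2026-08-21.)
-/

namespace Summit.CriticalPhenomena.PercolationContinuityZ3.Theorems

namespace TwoCopyLadderAllGrades

open TwoCopyLadderCubic

variable {R : Type*} [CommRing R]

/-- A positive cone: a predicate on a commutative ring closed under `+` and `*` and containing `0` and `1`
(instances below: `0 ≤ ·` in an ordered ring; "all coefficients `≥ 0`" in a polynomial ring). [this work] -/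
structure IsPosCone (P : R → Prop) : Prop where
  /-- `0 ∈ P` -/
  zero : P 0
  /-- `1 ∈ P` -/
  one : P 1
  /-- closed under addition -/
  add : ∀ {a b : R}, P a → P b → P (a + b)
  /-- closed under multiplication -/
  mul : ∀ {a b : R}, P a → P b → P (a * b)

namespace IsPosCone

variable {P : R → Prop}

/-- Natural numbers are in the cone. [this work] -/
theorem natCast (hP : IsPosCone P) : ∀ n : ℕ, P (n : R)
  | 0 => by simpa using hP.zero
  | n + 1 => by simpa [Nat.cast_succ] using hP.add (natCast hP n) hP.one

/-- Numerals are in the cone. [this work] -/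
theorem ofNat (hP : IsPosCone P) (n : ℕ) [n.AtLeastTwo] : P (OfNat.ofNat n : R) := by
  have h := hP.natCast (OfNat.ofNat n)
  rwa [Nat.cast_ofNat] at h

/-- Powers of cone elements are in the cone. [this work] -/
theorem pow (hP : IsPosCone P) {a : R} (ha : P a) : ∀ n : ℕ, P (a ^ n)
  | 0 => by simpa using hP.one
  | n + 1 => by rw [pow_succ]; exact hP.mul (pow hP ha n) ha

end IsPosCone

/-- `0 ≤ ·` is a positive cone in any ordered commutative ring. [this work] -/
theorem isPosCone_nonneg {S : Type*} [CommRing S] [LinearOrder S] [IsStrictOrderedRing S] :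
    IsPosCone (fun x : S => 0 ≤ x) :=
  ⟨le_refl 0, zero_le_one, fun ha hb => add_nonneg ha hb, fun ha hb => mul_nonneg ha hb⟩

/-- "Every coefficient is `≥ 0`" is a positive cone in the polynomial ring over an ordered commutative ring. [this work] -/
theorem isPosCone_coeff {S : Type*} [CommRing S] [LinearOrder S] [IsStrictOrderedRing S] :
    IsPosCone (fun p : Polynomial S => ∀ n, 0 ≤ p.coeff n) := by
  refine ⟨?_, ?_, ?_, ?_⟩
  · intro n; simp
  · intro n; rw [Polynomial.coeff_one]; split_ifs <;> norm_num
  · intro a b ha hb n; rw [Polynomial.coeff_add]; exact add_nonneg (ha n) (hb n)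
  · intro a b ha hb n; rw [Polynomial.coeff_mul]; exact Finset.sum_nonneg (fun ij _ => mul_nonneg (ha _) (hb _))

/-! ## The q-dependent moves and the side forms -/

/-- Pendant edge of weight `ρ` at the terminal `u` (new terminal `u'`), q-weighted: if the edge is absent the old `u` keeps its component,
which floats (weight `q`) exactly when it contained neither `x` nor `w`: `c ↦ ρc`, `p ↦ ρp`, `m ↦ ρm + qm + c`, `d ↦ ρd`,
`s ↦ ρs + qs + d + p`. [this work] -/
def qpendU (q ρ : R) (L : SVec R) : SVec R :=
  { c := ρ * L.c, p := ρ * L.p, m := ρ * L.m + q * L.m + L.c, d := ρ * L.d, s := ρ * L.s + q * L.s + L.d + L.p }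

/-- Pendant edge of weight `ρ` at the terminal `w`, q-weighted (mirror of `qpendU`). [this work] -/
def qpendW (q ρ : R) (L : SVec R) : SVec R :=
  { c := ρ * L.c, p := ρ * L.p + q * L.p + L.c, m := ρ * L.m, d := ρ * L.d, s := ρ * L.s + q * L.s + L.d + L.m }

/-- At `q = 0` the q-pendant move is the pendant move of gen 18. [this work] -/
theorem qpendW_zero (ρ : R) (L : SVec R) : qpendW 0 ρ L = pendW ρ L := by
  simp only [qpendW, pendW, zero_mul, add_zero, SVec.mk.injEq]
  refine ⟨trivial, trivial, trivial, trivial, ?_⟩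
  ring

/-- The all-grade spoke/rail side form `Aq = p(c+p+m+d) + q·ps + (1−q)(md − cs)` (at `q = 0`: `σ` of gen 18). [this work] -/
def Aq (q : R) (L : SVec R) : R :=
  L.p * (L.c + L.p + L.m + L.d) + q * L.p * L.s + (1 - q) * (L.m * L.d - L.c * L.s)

/-- The side form `Dl = cs − md`. [this work] -/
def Dl (L : SVec R) : R := L.c * L.s - L.m * L.d

/-- `Aq 0 = σ`. [this work] -/
theorem Aq_zero (L : SVec R) : Aq 0 L = sigma L := by
  unfold Aq sigma; ring

/-- `Aq` under a terminal rung: `Aq ↦ (1+t)·Aq`. [this work] -/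
theorem Aq_rungStep (q t : R) (X : SVec R) :
    Aq q (rungStep t X) = (t + 1) * Aq q X := by
  unfold Aq rungStep; ring

/-- `Aq` under a pendant edge at `u`: `Aq ↦ ρ(ρ+q)·Aq` exactly. [this work] -/
theorem Aq_qpendU (q ρ : R) (X : SVec R) :
    Aq q (qpendU q ρ X) = (ρ ^ 2 + q * ρ) * Aq q X := by
  unfold Aq qpendU; ring

/-- `Aq` under a pendant edge at `w`: `ρ²·Aq` plus a polynomial with nonnegative coefficients. [this work] -/
theorem Aq_qpendW (q ρ : R) (X : SVec R) :
    Aq q (qpendW q ρ X) = (ρ ^ 2) * Aq q X + (2 * q ^ 2 * ρ * X.p * X.s + q ^ 2 * ρ * X.c * X.s + q ^ 3 * X.p * X.s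
      + 2 * q * ρ * X.p * X.d + 2 * q * ρ * X.p * X.m + 2 * q * ρ * X.p ^ 2 + q * ρ * X.c * X.d + q * ρ * X.c * X.m
      + q * ρ * X.c * X.p + q ^ 2 * X.p * X.d + q ^ 2 * X.p * X.m + q ^ 2 * X.p ^ 2 + q ^ 2 * X.c * X.s
      + 2 * ρ * X.c * X.p + ρ * X.c ^ 2 + q * X.c * X.d + q * X.c * X.m + 2 * q * X.c * X.p + X.c ^ 2) := by
  unfold Aq qpendW; ring

/-- `Aq` vanishes after merging the terminals. [this work] -/
theorem Aq_mergeUW (q : R) (X : SVec R) : Aq q (mergeUW X) = 0 := by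
  unfold Aq mergeUW; ring

/-- `Dl` under a terminal rung. [this work] -/
theorem Dl_rungStep (t : R) (X : SVec R) :
    Dl (rungStep t X) = (t + 1) * Dl X + (t * X.p * X.s) := by
  unfold Dl rungStep; ring

/-- `Dl` under a pendant edge at `u`. [this work] -/
theorem Dl_qpendU (q ρ : R) (X : SVec R) :
    Dl (qpendU q ρ X) = (ρ ^ 2 + q * ρ) * Dl X + (ρ * X.c * X.p) := by
  unfold Dl qpendU; ring

/-- `Dl` under a pendant edge at `w`. [this work] -/
theorem Dl_qpendW (q ρ : R) (X : SVec R) :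
    Dl (qpendW q ρ X) = (ρ ^ 2) * Dl X + (q * ρ * X.c * X.s + ρ * X.c * X.d + ρ * X.c * X.m) := by
  unfold Dl qpendW; ring

/-- `Dl` vanishes after merging the terminals. [this work] -/
theorem Dl_mergeUW (X : SVec R) : Dl (mergeUW X) = 0 := by
  unfold Dl mergeUW; ring

/-! ## The all-grade spoke and rail forms -/

/-- `Bq = 2CP + C² + q(2PD + 2PM + 2P² + CD + CM + CP) + q²(2PS + CS)` (coefficient of `y₂¹` in the spoke form). [this work] -/
def Bq (q : R) (K : SVec R) : R :=
  2 * K.c * K.p + K.c ^ 2 + q * (2 * K.p * K.d + 2 * K.p * K.m + 2 * K.p ^ 2 + K.c * K.d + K.c * K.m + K.c * K.p)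
    + q ^ 2 * (2 * K.p * K.s + K.c * K.s)

/-- `C0q = (C + qP)(C + q(P+M+D) + q²S)` (coefficient of `y₂⁰` in the spoke form: the 1-sum case). [this work] -/
def C0q (q : R) (K : SVec R) : R := (K.c + q * K.p) * (K.c + q * (K.p + K.m + K.d) + q ^ 2 * K.s)

/-- The all-grade SPOKE form `P_{av,au₁}/q³ = y₂²·Aq K + y₂·Bq K + C0q K` (apex side = the single edge `aw₁` of weight `y₂`, whose
q-type vector is `(0,0,y₂,0,1)`; `K` = q-types of the other side; memo §2). [this work] -/
def Qspoke (q y₂ : R) (K : SVec R) : R := y₂ ^ 2 * Aq q K + y₂ * Bq q K + C0q q K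

/-- At `q = 0` the all-grade spoke form is the q³ spoke form `Bspoke` of gen 18. [this work] -/
theorem Qspoke_zero (y₂ : R) (K : SVec R) : Qspoke 0 y₂ K = Bspoke y₂ K := by
  unfold Qspoke Bspoke Aq Bq C0q sigma; ring

/-! ## Positivity along the orbit of the four moves -/

section Cone

variable {P : R → Prop}

/-- The S-vectors reachable from the one-vertex side `triv` by terminal rungs, q-pendant edges at `u` or `w` and merging, with
weights in the cone (every 3-terminal side of a contraction-minor of a ladder is of this form; memo §1). [this work] -/
inductive Orb (P : R → Prop) (q : R) : SVec R → Prop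
  /-- the one-vertex side -/
  | triv : Orb P q triv
  /-- an edge of weight `t` between the terminals -/
  | rung {t : R} {X : SVec R} : P t → Orb P q X → Orb P q (rungStep t X)
  /-- a pendant edge of weight `ρ` at `u` -/
  | pendU {ρ : R} {X : SVec R} : P ρ → Orb P q X → Orb P q (qpendU q ρ X)
  /-- a pendant edge of weight `ρ` at `w` -/
  | pendW {ρ : R} {X : SVec R} : P ρ → Orb P q X → Orb P q (qpendW q ρ X)
  /-- identification of the terminals -/
  | merge {X : SVec R} : Orb P q X → Orb P q (mergeUW X)

/-- The invariant: all entries, `Aq` and `Dl` lie in the cone. [this work] -/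
structure GoodQ (P : R → Prop) (q : R) (X : SVec R) : Prop where
  /-- `c ∈ P` -/
  hc : P X.c
  /-- `p ∈ P` -/
  hp : P X.p
  /-- `m ∈ P` -/
  hm : P X.m
  /-- `d ∈ P` -/
  hd : P X.d
  /-- `s ∈ P` -/
  hs : P X.s
  /-- `Aq ∈ P` -/
  hA : P (Aq q X)
  /-- `Dl ∈ P` -/
  hD : P (Dl X)

/-- `triv` is good. [this work] -/
theorem goodQ_triv (hP : IsPosCone P) (q : R) : GoodQ P q (triv : SVec R) := by
  refine ⟨?_, ?_, ?_, ?_, ?_, ?_, ?_⟩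
  · show P 1; exact hP.one
  · show P 0; exact hP.zero
  · show P 0; exact hP.zero
  · show P 0; exact hP.zero
  · show P 0; exact hP.zero
  · have e : Aq q (triv : SVec R) = 0 := by unfold Aq triv; ring
    rw [e]; exact hP.zero
  · have e : Dl (triv : SVec R) = 0 := by unfold Dl triv; ring
    rw [e]; exact hP.zero

/-- A terminal rung preserves goodness. [this work] -/
theorem goodQ_rungStep (hP : IsPosCone P) {q t : R} (ht : P t) {X : SVec R} (h : GoodQ P q X) :
    GoodQ P q (rungStep t X) := by
  obtain ⟨hc, hp, hm, hd, hs, hA, hD⟩ := h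
  refine ⟨?_, hp, hm, ?_, hs, ?_, ?_⟩
  · show P (X.c + t * (X.c + X.p + X.m)); apply_rules (maxDepth := 3000) [hP.add, hP.mul, hP.pow, hP.zero, hP.one, hP.ofNat]
  · show P (X.d + t * (X.d + X.s)); apply_rules (maxDepth := 3000) [hP.add, hP.mul, hP.pow, hP.zero, hP.one, hP.ofNat]
  · rw [Aq_rungStep]; apply_rules (maxDepth := 3000) [hP.add, hP.mul, hP.pow, hP.zero, hP.one, hP.ofNat]
  · rw [Dl_rungStep]; apply_rules (maxDepth := 3000) [hP.add, hP.mul, hP.pow, hP.zero, hP.one, hP.ofNat]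

/-- A pendant edge at `u` preserves goodness. [this work] -/
theorem goodQ_qpendU (hP : IsPosCone P) {q ρ : R} (hq : P q) (hρ : P ρ) {X : SVec R} (h : GoodQ P q X) :
    GoodQ P q (qpendU q ρ X) := by
  obtain ⟨hc, hp, hm, hd, hs, hA, hD⟩ := h
  refine ⟨?_, ?_, ?_, ?_, ?_, ?_, ?_⟩
  · show P (ρ * X.c); apply_rules (maxDepth := 3000) [hP.add, hP.mul, hP.pow, hP.zero, hP.one, hP.ofNat]
  · show P (ρ * X.p); apply_rules (maxDepth := 3000) [hP.add, hP.mul, hP.pow, hP.zero, hP.one, hP.ofNat]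
  · show P (ρ * X.m + q * X.m + X.c); apply_rules (maxDepth := 3000) [hP.add, hP.mul, hP.pow, hP.zero, hP.one, hP.ofNat]
  · show P (ρ * X.d); apply_rules (maxDepth := 3000) [hP.add, hP.mul, hP.pow, hP.zero, hP.one, hP.ofNat]
  · show P (ρ * X.s + q * X.s + X.d + X.p); apply_rules (maxDepth := 3000) [hP.add, hP.mul, hP.pow, hP.zero, hP.one, hP.ofNat]
  · rw [Aq_qpendU]; apply_rules (maxDepth := 3000) [hP.add, hP.mul, hP.pow, hP.zero, hP.one, hP.ofNat]
  · rw [Dl_qpendU]; apply_rules (maxDepth := 3000) [hP.add, hP.mul, hP.pow, hP.zero, hP.one, hP.ofNat]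

/-- A pendant edge at `w` preserves goodness. [this work] -/
theorem goodQ_qpendW (hP : IsPosCone P) {q ρ : R} (hq : P q) (hρ : P ρ) {X : SVec R} (h : GoodQ P q X) :
    GoodQ P q (qpendW q ρ X) := by
  obtain ⟨hc, hp, hm, hd, hs, hA, hD⟩ := h
  refine ⟨?_, ?_, ?_, ?_, ?_, ?_, ?_⟩
  · show P (ρ * X.c); apply_rules (maxDepth := 3000) [hP.add, hP.mul, hP.pow, hP.zero, hP.one, hP.ofNat]
  · show P (ρ * X.p + q * X.p + X.c); apply_rules (maxDepth := 3000) [hP.add, hP.mul, hP.pow, hP.zero, hP.one, hP.ofNat]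
  · show P (ρ * X.m); apply_rules (maxDepth := 3000) [hP.add, hP.mul, hP.pow, hP.zero, hP.one, hP.ofNat]
  · show P (ρ * X.d); apply_rules (maxDepth := 3000) [hP.add, hP.mul, hP.pow, hP.zero, hP.one, hP.ofNat]
  · show P (ρ * X.s + q * X.s + X.d + X.m); apply_rules (maxDepth := 3000) [hP.add, hP.mul, hP.pow, hP.zero, hP.one, hP.ofNat]
  · rw [Aq_qpendW]; apply_rules (maxDepth := 3000) [hP.add, hP.mul, hP.pow, hP.zero, hP.one, hP.ofNat]
  · rw [Dl_qpendW]; apply_rules (maxDepth := 3000) [hP.add, hP.mul, hP.pow, hP.zero, hP.one, hP.ofNat]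

/-- Merging the terminals preserves goodness. [this work] -/
theorem goodQ_mergeUW (hP : IsPosCone P) {q : R} {X : SVec R} (h : GoodQ P q X) : GoodQ P q (mergeUW X) := by
  obtain ⟨hc, hp, hm, hd, hs, hA, hD⟩ := h
  refine ⟨?_, ?_, ?_, ?_, ?_, ?_, ?_⟩
  · show P (X.c + X.p + X.m); apply_rules (maxDepth := 3000) [hP.add, hP.mul, hP.pow, hP.zero, hP.one, hP.ofNat]
  · show P 0; exact hP.zero
  · show P 0; exact hP.zero
  · show P (X.d + X.s); apply_rules (maxDepth := 3000) [hP.add, hP.mul, hP.pow, hP.zero, hP.one, hP.ofNat]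
  · show P 0; exact hP.zero
  · rw [Aq_mergeUW]; exact hP.zero
  · rw [Dl_mergeUW]; exact hP.zero

/-- Every vector of the orbit is good (`Aq`, `Dl` and the entries lie in the cone). [this work] -/
theorem goodQ_of_orb (hP : IsPosCone P) {q : R} (hq : P q) {X : SVec R} (hX : Orb P q X) : GoodQ P q X := by
  induction hX with
  | triv => exact goodQ_triv hP q
  | rung ht _ ih => exact goodQ_rungStep hP ht ih
  | pendU hρ _ ih => exact goodQ_qpendU hP hq hρ ih
  | pendW hρ _ ih => exact goodQ_qpendW hP hq hρ ih
  | merge _ ih => exact goodQ_mergeUW hP ih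

/-- THEOREM (all-grade spokes, algebraic form): the spoke form lies in the cone for every side of the orbit. [this work] -/
theorem Qspoke_pos (hP : IsPosCone P) {q y₂ : R} (hq : P q) (hy : P y₂) {K : SVec R} (hK : Orb P q K) :
    P (Qspoke q y₂ K) := by
  obtain ⟨hc, hp, hm, hd, hs, hA, hD⟩ := goodQ_of_orb hP hq hK
  unfold Qspoke Bq C0q
  apply_rules (maxDepth := 3000) [hP.add, hP.mul, hP.pow, hP.zero, hP.one, hP.ofNat]

/-! ## Ladder sides -/

/-- One ladder column, q-weighted: the rung `t` between the current terminals, then the rails `r₁` (at `u`) and `r₂` (at `w`);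
equal to the q-weighted type recursion of a column (validated against brute force, memo §1; at `q = 0` it is `colStep`). [this work] -/
def qcolStep (q t r₁ r₂ : R) (L : SVec R) : SVec R := qpendU q r₁ (qpendW q r₂ (rungStep t L))

/-- At `q = 0` the q-column step is the column step of gen 18. [this work] -/
theorem qcolStep_zero (t r₁ r₂ : R) (L : SVec R) : qcolStep 0 t r₁ r₂ L = colStep t r₁ r₂ L := by
  simp only [qcolStep, qpendU, qpendW, rungStep, colStep, SVec.mk.injEq]
  refine ⟨?_, ?_, ?_, ?_, ?_⟩ <;> ring

/-- The q-type vector of a ladder side: the base column (apex joined to `u₁, w₁` by `y₁, y₂`) followed by columns `(t, r₁, r₂)`. [this work] -/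
def qseg (q y₁ y₂ : R) : List (R × R × R) → SVec R
  | [] => base y₁ y₂
  | (t, r₁, r₂) :: cols => qcolStep q t r₁ r₂ (qseg q y₁ y₂ cols)

/-- The base column is `qpendU y₁ (qpendW y₂ triv)`. [this work] -/
theorem base_eq (q y₁ y₂ : R) : base y₁ y₂ = qpendU q y₁ (qpendW q y₂ triv) := by
  simp only [base, qpendU, qpendW, triv, SVec.mk.injEq]
  refine ⟨?_, ?_, ?_, ?_, ?_⟩ <;> ring

/-- Ladder sides lie in the orbit. [this work] -/
theorem orb_qseg {q y₁ y₂ : R} (hy₁ : P y₁) (hy₂ : P y₂) :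
    ∀ cols : List (R × R × R), (∀ trr ∈ cols, P trr.1 ∧ P trr.2.1 ∧ P trr.2.2) → Orb P q (qseg q y₁ y₂ cols)
  | [], _ => by
      show Orb P q (base y₁ y₂)
      rw [base_eq q y₁ y₂]
      exact Orb.pendU hy₁ (Orb.pendW hy₂ Orb.triv)
  | (t, r₁, r₂) :: cols, h => by
      have hcols : ∀ trr ∈ cols, P trr.1 ∧ P trr.2.1 ∧ P trr.2.2 := fun trr htrr => h trr (List.mem_cons_of_mem _ htrr)
      obtain ⟨ht, h1, h2⟩ := h (t, r₁, r₂) List.mem_cons_self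
      exact Orb.pendU h1 (Orb.pendW h2 (Orb.rung ht (orb_qseg hy₁ hy₂ cols hcols)))

/-- THEOREM L∞-spoke (cone form): for the spoke pair `(av, au₁)` of `L_r + av` — apex side = edge `aw₁` (weight `y₂`), other side =
ladder side from `v` followed by the terminal rung `u₁w₁` (weight `t`) — the all-grade form `P_{av,au₁}/q³` lies in the cone. [this work] -/
theorem spoke_allGrades (hP : IsPosCone P) {q y₂ t z₁ z₂ : R} (hq : P q) (hy₂ : P y₂) (ht : P t) (hz₁ : P z₁) (hz₂ : P z₂)
    (cols : List (R × R × R)) (h : ∀ trr ∈ cols, P trr.1 ∧ P trr.2.1 ∧ P trr.2.2) :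
    P (Qspoke q y₂ (rungStep t (qseg q z₁ z₂ cols))) :=
  Qspoke_pos hP hq hy₂ (Orb.rung ht (orb_qseg hz₁ hz₂ cols h))

end Cone

/-! ## The two headline instances (spokes) -/

section Real

variable {S : Type*} [CommRing S] [LinearOrder S] [IsStrictOrderedRing S]

/-- THEOREM L∞-spoke, real form: for every `q ≥ 0` and nonnegative weights the two-copy core `P_{L_r+av; av, au₁}(q;y)/q³` is `≥ 0`;
for `0 < q < 1` this is Rayleigh negative correlation of the apex edge with the spoke in the random-cluster model on `L_r + av`
(via `(1−q)P = qΔ`), for all `r`. [this work] -/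
theorem spoke_allq_nonneg {q y₂ t z₁ z₂ : S} (hq : 0 ≤ q) (hy₂ : 0 ≤ y₂) (ht : 0 ≤ t) (hz₁ : 0 ≤ z₁) (hz₂ : 0 ≤ z₂)
    (cols : List (S × S × S)) (h : ∀ trr ∈ cols, 0 ≤ trr.1 ∧ 0 ≤ trr.2.1 ∧ 0 ≤ trr.2.2) :
    0 ≤ Qspoke q y₂ (rungStep t (qseg q z₁ z₂ cols)) :=
  spoke_allGrades (P := fun x : S => 0 ≤ x) isPosCone_nonneg hq hy₂ ht hz₁ hz₂ cols h

end Real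

section Graded

variable {S : Type*} [CommRing S] [LinearOrder S] [IsStrictOrderedRing S]

open Polynomial

/-- THEOREM L∞-spoke, graded form: with `q = X` the polynomial variable and weights any polynomials with nonnegative coefficients
(e.g. nonnegative constants), EVERY coefficient of the spoke form is `≥ 0` — the CONJ-L edge shadow `H_{L_r}([a~v], J_{au₁}) ⪰ 0`
at all grades, all `r`. [this work] -/
theorem spoke_coeff_nonneg {y₂ t z₁ z₂ : S[X]} (hy₂ : ∀ n, 0 ≤ y₂.coeff n) (ht : ∀ n, 0 ≤ t.coeff n)
    (hz₁ : ∀ n, 0 ≤ z₁.coeff n) (hz₂ : ∀ n, 0 ≤ z₂.coeff n) (cols : List (S[X] × S[X] × S[X]))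
    (h : ∀ trr ∈ cols, (∀ n, 0 ≤ trr.1.coeff n) ∧ (∀ n, 0 ≤ trr.2.1.coeff n) ∧ (∀ n, 0 ≤ trr.2.2.coeff n)) (n : ℕ) :
    0 ≤ (Qspoke X y₂ (rungStep t (qseg X z₁ z₂ cols))).coeff n :=
  spoke_allGrades (P := fun p : S[X] => ∀ n, 0 ≤ p.coeff n) isPosCone_coeff (fun n => by rw [coeff_X]; split_ifs <;> norm_num)
    hy₂ ht hz₁ hz₂ cols h n

end Graded

end TwoCopyLadderAllGrades

end Summit.CriticalPhenomena.PercolationContinuityZ3.Theorems
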